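import Mathlib

/-!
# The sector-1 statement (S1) of row 2′MM0 FAILS while (MM0⁻) holds — a kernel certificate
(blind cell PercRepro2, seat night-1 g2, 2026-08-24; `proofs/NIGHT1-MM0.md`)

Setting (`MM0Sector.lean`): a finite graph `H`, root `s`, avoided vertex `t`, marker `b`, a free edge
`{u, w}` absent from `H`, a vertex `v`; `R = {s ↮ t}`, `y = 1[b ∈ C(s)]`, `Z₀ = 1[v ∈ C(t)]`,
`gate = {s ↮ t in H + uw}`, `Z = 1[v ↔ t in H + uw]`, `hits = {C(t) meets {u, w}}`, `ȳ = P(y | R)`,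
`c = P(Z₀ | R)`.  The statement (MM0⁻) of record is `E[(y − ȳ)(Z − c); gate] ≤ 0`; it splits exactly
as sector 0 (`C(t)` avoids `{s, u, w}`, a THEOREM: `MM0Sector.sector0_nonpos`) plus sector 1
(`gate ∩ hits`), and the sector-1 statement (S1) `E[(y − ȳ)(Z − c); gate ∩ hits] ≤ 0` was the
candidate «open content» (it holds on every instance of the `k/8` census at `n = 6`).

This file checks in the kernel that (S1) FAILS on a 7-edge graph while (MM0⁻) holds there, so the
sector split is NOT a proof route — the sector-0 slack is needed.  Witness (found by a `(1+1)`-ES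
adversary in logit weight space, kit `j208298`, re-checked exactly by two evaluators): the graph
`c6_00023` on vertices `0..5` with edges `{0,1}, {1,3}, {2,4}, {2,5}, {3,4}, {3,5}, {4,5}` and weights
`9/64, 11/64, 43/64, 31/64, 63/64, 51/64, 55/64`; `s = 1`, `t = 4`, `b = 3`, `u = 5`, `w = 0`
(free edge `{0, 5}`), `v = 2`.  With masses in units of `64^{-7}` (`a = P(R)` etc.):

  `a = 3645424233664`, `Y_R = 3291966656`, `Z_R = 3010771539520`;
  gate: `g = 3143417764714`, `Y_E = 2986591157`, `Z_E = 2592841739092`, `YZ_E = 2141819306`;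
  sector 1: `M₁ = 3067817310250`, `Y₁ = 1866183605`, `Z₁ = 2554015447060`, `YZ₁ = 1566409130`,

the cleared forms `F(X) = a²·YZ_X − a·Y_R·Z_X − a·Z_R·Y_X + Y_R·Z_R·M_X` (`= P(R)²·64^{21}·
E[(y − ȳ)(Z − c); X]`) are

  `F(gate) = −4276712104992442698227271001976832 < 0`   ((MM0⁻) holds),
  `F(sector 1) = 90307736660118227771739579863040 > 0`   ((S1) FAILS),
  `F(sector 0) = F(gate) − F(sector 1) = −4367019841652560925999010581839872 < 0`.

In conditional terms: `Cov(y, Z | sector 1) = +4.16·10⁻⁶` exceeds the sector-1 shift product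
`(E[y | sector 1] − ȳ)(P(Z | sector 1) − c) = −1.95·10⁻⁶` in absolute value (the route-alternative
effect: `u ∈ C_{H+uw}(t)` together with `b ∈ C(s)` forces the `v`-route), while sector 0 contributes
`−9.0·10⁻⁵`.  The eleven masses are established by `decide` (kernel evaluation, standard axioms
only); the forms follow by `norm_num`.
-/

namespace Summit.Ventures.PercRepro2.MM0SectorWitness

/-- An undirected edge `{u, v}`, open with probability `w / 64`. -/
structure Edge where
  u : Nat
  v : Nat
  w : Nat

/-- The seven edges of `c6_00023` (vertices `0..5`) with the witness weights (out of 64). -/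
def edge : Nat → Edge
  | 0 => ⟨0, 1, 9⟩    -- {0,1}, p = 9/64
  | 1 => ⟨1, 3, 11⟩   -- {1,3}, p = 11/64
  | 2 => ⟨2, 4, 43⟩   -- {2,4}, p = 43/64
  | 3 => ⟨2, 5, 31⟩   -- {2,5}, p = 31/64
  | 4 => ⟨3, 4, 63⟩   -- {3,4}, p = 63/64
  | 5 => ⟨3, 5, 51⟩   -- {3,5}, p = 51/64
  | _ => ⟨4, 5, 55⟩   -- {4,5}, p = 55/64

/-- The root `s = 1`. -/
def s : Nat := 1
/-- The avoided vertex `t = 4`. -/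
def t : Nat := 4
/-- The marker `b = 3`. -/
def b : Nat := 3
/-- One endpoint of the free edge, `u = 5`. -/
def u : Nat := 5
/-- The other endpoint of the free edge, `w = 0` (the free edge `{0, 5}` is absent from `H`). -/
def w : Nat := 0
/-- The vertex `v = 2`. -/
def v : Nat := 2

/-- Edge `i` is open in the configuration `c ∈ [0, 2^7)` iff bit `i` of `c` is set. -/
def isOpen (c i : Nat) : Bool := c.testBit i

/-- Product Bernoulli weight of the configuration `c`, in units of `64^{-7}`. -/
def wt (c : Nat) : Nat :=
  (List.range 7).foldl (fun acc i => acc * (if isOpen c i then (edge i).w else 64 - (edge i).w)) 1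

/-- Vertex sets are bitmasks over `0..5`; `mem S x` is `x ∈ S`. -/
def mem (S x : Nat) : Bool := S.testBit x

/-- One expansion step of a vertex set along the open edges of `H` (undirected). -/
def step (c S : Nat) : Nat :=
  (List.range 7).foldl (fun S i =>
    let e := edge i
    if isOpen c i then
      if mem S e.u || mem S e.v then S ||| (1 <<< e.u) ||| (1 <<< e.v) else S
    else S) S

/-- `n`-fold iteration. -/
def iter (f : Nat → Nat) : Nat → Nat → Nat
  | 0, S => S
  | n + 1, S => iter f n (f S)

/-- `C(x)` in `H`: the open cluster of `x` (six steps suffice on six vertices). -/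
def reach (c x : Nat) : Nat := iter (step c) 6 (1 <<< x)

/-- `R = {s ↮ t in H}`. -/
def RT (c : Nat) : Bool := !(mem (reach c s) t)
/-- The bridge `{s ↔ u, t ↔ w} ∪ {s ↔ w, t ↔ u}`: the free edge would join `s` to `t`. -/
def bridge (c : Nat) : Bool :=
  (mem (reach c s) u && mem (reach c t) w) || (mem (reach c s) w && mem (reach c t) u)
/-- The gate `{s ↮ t in H + uw} = R ∖ bridge`. -/
def gate (c : Nat) : Bool := RT c && !bridge c
/-- `hits = {C(t) meets {u, w}}`. -/
def hits (c : Nat) : Bool := mem (reach c t) u || mem (reach c t) w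
/-- `y = 1[b ∈ C(s)]`. -/
def y (c : Nat) : Bool := mem (reach c s) b
/-- `Z₀ = 1[v ∈ C(t)]`. -/
def z0 (c : Nat) : Bool := mem (reach c t) v
/-- `Z = 1[v ↔ t in H + uw] = Z₀ ∪ {v ↔ u, t ↔ w} ∪ {v ↔ w, t ↔ u}`. -/
def z (c : Nat) : Bool :=
  z0 c || (mem (reach c v) u && mem (reach c t) w) || (mem (reach c v) w && mem (reach c t) u)

/-- `64^7 · P(R ∩ F)`. -/
def massR (F : Nat → Bool) : Nat :=
  (List.range 128).foldl (fun acc c => if RT c && F c then acc + wt c else acc) 0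
/-- `64^7 · P(gate ∩ F)`. -/
def massE (F : Nat → Bool) : Nat :=
  (List.range 128).foldl (fun acc c => if gate c && F c then acc + wt c else acc) 0
/-- `64^7 · P(gate ∩ hits ∩ F)` (sector 1). -/
def mass1 (F : Nat → Bool) : Nat :=
  (List.range 128).foldl (fun acc c => if gate c && hits c && F c then acc + wt c else acc) 0

/-- Total mass `64^7` (sanity: the weights sum to one). -/
theorem total_mass : (List.range 128).foldl (fun acc c => acc + wt c) 0 = 64 ^ 7 := by
  decide +kernel

/-- The gate is a sub-event of `R` (sanity). -/
theorem gate_subset : ∀ c, c < 128 → gate c = true → RT c = true := by decide +kernel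

/-! ### The eleven masses (kernel evaluation). -/

/-- `a = 64^7 · P(R)`. -/
theorem MR_eq   : massR (fun _ => true) = 3645424233664 := by decide +kernel
/-- `Y_R = 64^7 · P(y, R)`. -/
theorem MYR_eq  : massR y = 3291966656 := by decide +kernel
/-- `Z_R = 64^7 · P(Z₀, R)`. -/
theorem MZR_eq  : massR z0 = 3010771539520 := by decide +kernel
/-- `g = 64^7 · P(gate)`. -/
theorem ME_eq   : massE (fun _ => true) = 3143417764714 := by decide +kernel
/-- `Y_E = 64^7 · P(y, gate)`. -/
theorem MYE_eq  : massE y = 2986591157 := by decide +kernel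
/-- `Z_E = 64^7 · P(Z, gate)`. -/
theorem MZE_eq  : massE z = 2592841739092 := by decide +kernel
/-- `YZ_E = 64^7 · P(y, Z, gate)`. -/
theorem MYZE_eq : massE (fun c => y c && z c) = 2141819306 := by decide +kernel
/-- `M₁ = 64^7 · P(gate ∩ hits)`. -/
theorem M1_eq   : mass1 (fun _ => true) = 3067817310250 := by decide +kernel
/-- `Y₁ = 64^7 · P(y, gate ∩ hits)`. -/
theorem MY1_eq  : mass1 y = 1866183605 := by decide +kernel
/-- `Z₁ = 64^7 · P(Z, gate ∩ hits)`. -/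
theorem MZ1_eq  : mass1 z = 2554015447060 := by decide +kernel
/-- `YZ₁ = 64^7 · P(y, Z, gate ∩ hits)`. -/
theorem MYZ1_eq : mass1 (fun c => y c && z c) = 1566409130 := by decide +kernel

/-- The cleared form `F = a²·YZ_X − a·Y_R·Z_X − a·Z_R·Y_X + Y_R·Z_R·M_X` of
`P(R)² · E[(y − ȳ)(Z − c); X]` (all masses in the same units). -/
def form (a YR ZR MX YX ZX YZX : ℚ) : ℚ :=
  a ^ 2 * YZX - a * YR * ZX - a * ZR * YX + YR * ZR * MX

/-- `F(gate)`: the (MM0⁻) form on the witness. -/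
noncomputable def Fgate : ℚ :=
  form (massR (fun _ => true)) (massR y) (massR z0) (massE (fun _ => true)) (massE y) (massE z)
    (massE (fun c => y c && z c))

/-- `F(sector 1)`: the (S1) form on the witness. -/
noncomputable def Fsector1 : ℚ :=
  form (massR (fun _ => true)) (massR y) (massR z0) (mass1 (fun _ => true)) (mass1 y) (mass1 z)
    (mass1 (fun c => y c && z c))

/-- **(MM0⁻) holds on the witness**: `F(gate) = −4276712104992442698227271001976832`. -/
theorem Fgate_eq : Fgate = -4276712104992442698227271001976832 := by
  unfold Fgate form
  rw [MR_eq, MYR_eq, MZR_eq, ME_eq, MYE_eq, MZE_eq, MYZE_eq]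
  norm_num

/-- `F(gate) < 0`. -/
theorem Fgate_neg : Fgate < 0 := by rw [Fgate_eq]; norm_num

/-- **(S1) FAILS on the witness**: `F(sector 1) = 90307736660118227771739579863040 > 0`. -/
theorem Fsector1_eq : Fsector1 = 90307736660118227771739579863040 := by
  unfold Fsector1 form
  rw [MR_eq, MYR_eq, MZR_eq, M1_eq, MY1_eq, MZ1_eq, MYZ1_eq]
  norm_num

/-- `F(sector 1) > 0`: the sector-1 part of (MM0⁻) is POSITIVE here. -/
theorem Fsector1_pos : 0 < Fsector1 := by rw [Fsector1_eq]; norm_num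

/-- The sector-0 part `F(gate) − F(sector 1)` is negative (it pays for sector 1). -/
theorem Fsector0_neg : Fgate - Fsector1 < 0 := by rw [Fgate_eq, Fsector1_eq]; norm_num

end Summit.Ventures.PercRepro2.MM0SectorWitness
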